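import Literature.Computability.Cryptography.LiuPassCondFromRegular
import Literature.Computability.Complexity.HashBricks
import Literature.Computability.Complexity.LengthCompare
import Literature.Computability.Complexity.StackUnary
import HarnessLib

/-!
# The reduction of Liu–Pass Thm 5.5 is polynomial time (discharge of `condRedRun_polyTime`)

`LiuPassCondFromRegular.lean` proves Liu–Pass's Thm 5.5 (FOCS 2020: cond EP-PRGs from one-way
functions) from Lemma 5.3 (`liuPass_lemma53`) and two efficiency facts. This file discharges the
second efficiency fact, `condRedRun_polyTime_holds : condRedRun_polyTime`: for every PPT
distinguisher `D'` the run function `CondParams.redRun Q D' qD` of the reduction — decode the advice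
`(N - seedLen n, κ)` from the *number* of coins (`|coins| mod Base(n)`, then `divMod` by `K_b(n)`),
append the first `N - seedLen n` coins to the sample, cut to `N + γ⌊log₂ N⌋`, and run `D'` once on
`⟨1^N, ·⟩` with the next `κ` coins — is polynomial-time computable on the pair presentation
`⟨input, coins⟩`.

As in `YaoInvProgram.lean` / `LiuPassPaddingProofs.lean` no machine is programmed: the run function
is written as a pipeline of the tree's `FP` bricks (`PlumbingBricks.lean`: `polyFn`, `takeFn`,
`dropFn`, `modLenFn`, `divModFn`; `HashBricks.umulFn`; `onesFn`, `concatFn`, `fanoutFn`), plus one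
new brick proved here:

* `CondRed.logU w = 1^{⌊log₂ |w|⌋}` (`logU_apply`, `logU_mem_FP`): `|w|` rounds of "double a capped
  power `p ↦ (p‖p) ↾ (|w|+1)` and count the rounds with `|p| ≤ |w|`" (`iterate_mem_FP_of_growth`);
* `CondRed.seedU c w = 1^{seedLen |w|}`, `CondRed.innerU γ w = 1^{|w| + γ⌊log₂ |w|⌋}` and the
  arithmetic of `K_b`, `Base` in unary; `CondRed.redF_boolPair`: the pipeline computes `redRun`;
* `condRedRun_polyTime_holds`, and `condEPPRG_of_OWFExist_of_lemma53_gen`: Thm 5.5 from Lemma 5.3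
  and the single remaining efficiency fact `condGen_polyTime`.

## References

* Y. Liu, R. Pass, *On one-way functions and Kolmogorov complexity*, FOCS 2020
  (arXiv:2009.11514), proof of Thm 5.5 ("the pseudorandomness property of `G'_{δ,γ}` follows
  directly").
* S. Arora, B. Barak, *Computational Complexity: A Modern Approach*, CUP 2009, §1.3 (closure of
  polynomial time under composition), §1.4.1 (clocked loops), §7.1 (probabilistic machines).
-/

namespace Literature.Computability.Cryptography

open _root_.Computability Polynomial Complexity Complexity.Brick Complexity.Plumb Complexity.OracleCompose

namespace CondRed

/-! ### Unary words -/

/-- `1 :: 1ᵃ = 1ᵃ⁺¹`. [folklore] -/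
theorem true_cons_ones (a : ℕ) : true :: ones a = ones (a + 1) := by simp [ones, List.replicate_succ]

/-- Mathlib's unary numerals are `1ⁿ`. [folklore] -/
theorem unaryEncodeNat_eq_ones (n : ℕ) : unaryEncodeNat n = ones n := Complexity.unaryEncodeNat_eq_replicate n

/-! ### A unary logarithm brick `w ↦ 1^{⌊log₂ |w|⌋}` -/

/-- On the state `⟨w, ⟨p, d⟩⟩`: the capped double `(p ‖ p) ↾ (|w| + 1)`. [folklore] -/
noncomputable def powNext : List Bool → List Bool :=
  takeFn ∘ fanoutFn (List.cons true ∘ fstF) (concatFn ∘ fanoutFn (nthF 1) (nthF 1))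

/-- The test `[|powNext| ≤ |w|]`. [folklore] -/
noncomputable def powLe : List Bool → List Bool := lenLeFn X ∘ fanoutFn fstF powNext

/-- The counter update: `d ↦ 1 :: d` when the doubled power still fits below `|w|`. [folklore] -/
noncomputable def cntNext : List Bool → List Bool := iteFn powLe (List.cons true ∘ sndPow 1) (sndPow 1)

/-- One round of the logarithm loop on `⟨w, ⟨p, d⟩⟩`. [folklore] -/
noncomputable def logRound : List Bool → List Bool := fanoutFn fstF (fanoutFn powNext cntNext)

/-- Value of `powNext` on every word. [folklore] -/
theorem powNext_apply (S : List Bool) : powNext S = (nthF 1 S ++ nthF 1 S).take ((fstF S).length + 1) := by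
  simp [powNext]

/-- `powNext` is never longer than `|w| + 1`. [folklore] -/
theorem length_powNext_le (S : List Bool) : (powNext S).length ≤ (fstF S).length + 1 := by
  rw [powNext_apply]; exact List.length_take_le _ _

/-- Value of `powLe` on every word. [folklore] -/
theorem powLe_apply (S : List Bool) : powLe S = [decide ((powNext S).length ≤ (fstF S).length)] := by
  simp [powLe, lenLeFn_boolPair]

/-- Value of `cntNext` on every word. [folklore] -/
theorem cntNext_apply (S : List Bool) :
    cntNext S = if (powNext S).length ≤ (fstF S).length then true :: sndPow 1 S else sndPow 1 S := by
  unfold cntNext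
  split_ifs with h
  · rw [iteFn_apply_true (by rw [powLe_apply, decide_eq_true h])]; rfl
  · rw [iteFn_apply_false (by rw [powLe_apply, decide_eq_false h])]

/-- `cntNext` grows the counter by at most one. [folklore] -/
theorem length_cntNext_le (S : List Bool) : (cntNext S).length ≤ (sndPow 1 S).length + 1 := by
  rw [cntNext_apply]; split_ifs <;> simp

/-- The round keeps the first component. [folklore] -/
theorem fstF_logRound (S : List Bool) : (boolUnpair (logRound S)).1 = (boolUnpair S).1 := by
  simp [logRound, fstF]

/-- Linear growth of the round (in the preserved first component), on every word. [folklore] -/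
theorem length_logRound_le (S : List Bool) :
    (logRound S).length ≤ S.length + 7 * ((boolUnpair S).1.length + 1) := by
  have h1 := length_fstF_sndF_le S
  have h2 := length_fstF_sndF_le (sndF S)
  have h3 := length_powNext_le S
  have h4 := length_cntNext_le S
  have e2 : sndPow 1 S = sndF (sndF S) := rfl
  have e3 : (boolUnpair S).1 = fstF S := rfl
  rw [e2] at h4
  rw [e3]
  simp only [logRound, fanoutFn_apply, length_boolPair]
  omega

/-- Value of the round on a state. [folklore] -/
theorem logRound_state (w p d : List Bool) :
    logRound (boolPair w (boolPair p d)) =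
      boolPair w (boolPair ((p ++ p).take (w.length + 1))
        (if ((p ++ p).take (w.length + 1)).length ≤ w.length then true :: d else d)) := by
  have hp : powNext (boolPair w (boolPair p d)) = (p ++ p).take (w.length + 1) := by
    rw [powNext_apply]; simp [nthF]
  have hc := cntNext_apply (boolPair w (boolPair p d))
  rw [hp] at hc
  simp only [fstF_boolPair, sndPow_succ_boolPair, sndPow_zero_boolPair] at hc
  simp only [logRound, fanoutFn_apply, fstF_boolPair, hp, hc]

/-- **The loop invariant**: after `k` rounds the power is `1^{min 2ᵏ (|w|+1)}` and the counter is
`1^{min k ⌊log₂ |w|⌋}`. [folklore] -/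
theorem iterate_logRound (w : List Bool) : ∀ k : ℕ,
    logRound^[k] (boolPair w (boolPair [true] [])) =
      boolPair w (boolPair (ones (min (2 ^ k) (w.length + 1))) (ones (min k (Nat.log 2 w.length))))
  | 0 => by simp [ones]
  | k + 1 => by
    rw [Function.iterate_succ_apply', iterate_logRound w k, logRound_state]
    set n := w.length with hn
    have hpow : (ones (min (2 ^ k) (n + 1)) ++ ones (min (2 ^ k) (n + 1))).take (n + 1) = ones (min (2 ^ (k + 1)) (n + 1)) := by
      rw [Com.ones_append, ones, ones, List.take_replicate]
      congr 1
      rw [Nat.pow_succ]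
      omega
    rw [hpow, List.length_replicate]
    congr 2
    by_cases h : 2 ^ (k + 1) ≤ n
    · have hk : k + 1 ≤ Nat.log 2 n := Nat.le_log_of_pow_le (by norm_num) h
      rw [if_pos (by omega), true_cons_ones, Nat.min_eq_left (by omega), Nat.min_eq_left hk]
    · rw [if_neg (by omega)]
      rcases Nat.eq_zero_or_pos n with h0 | hpos
      · simp [h0]
      · have hk : Nat.log 2 n < k + 1 := by
          by_contra hc
          exact h (Nat.pow_le_of_le_log hpos.ne' (by omega))
        rw [Nat.min_eq_right (by omega), Nat.min_eq_right (by omega)]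

/-- **`logU w = 1^{⌊log₂ |w|⌋}`**: `|w|` rounds of `logRound` from `⟨w, ⟨1, ε⟩⟩`, then the counter.
[Arora–Barak 2009, §1.3 (arithmetic on counters in polynomial time)] [folklore] -/
noncomputable def logU : List Bool → List Bool :=
  sndPow 1 ∘ (fun S => logRound^[(X : Polynomial ℕ).eval (boolUnpair S).1.length] S) ∘
    fanoutFn id (fun _ => boolPair [true] [])

/-- **`logU w = 1^{⌊log₂ |w|⌋}`.** [folklore] -/
@[simp] theorem logU_apply (w : List Bool) : logU w = ones (Nat.log 2 w.length) := by
  have h := iterate_logRound w w.length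
  simp only [logU, Function.comp_apply, fanoutFn_apply, id, boolUnpair_boolPair, eval_X]
  rw [h]
  simp [sndPow, Nat.min_eq_right (Nat.log_le_self 2 w.length)]

/-- `powNext ∈ FP`. [folklore] -/
theorem powNext_mem_FP : powNext ∈ FP :=
  comp_mem_FP takeFn_mem_FP (fanoutFn_mem_FP (comp_mem_FP (cons_mem_FP true) fstF_mem_FP)
    (comp_mem_FP concatFn_mem_FP (fanoutFn_mem_FP (nthF_mem_FP 1) (nthF_mem_FP 1))))

/-- `cntNext ∈ FP`. [folklore] -/
theorem cntNext_mem_FP : cntNext ∈ FP :=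
  iteFn_mem_FP (comp_mem_FP (lenLeFn_mem_FP X) (fanoutFn_mem_FP fstF_mem_FP powNext_mem_FP))
    (comp_mem_FP (cons_mem_FP true) (sndPow_mem_FP 1)) (sndPow_mem_FP 1)

/-- `logRound ∈ FP`. [folklore] -/
theorem logRound_mem_FP : logRound ∈ FP :=
  fanoutFn_mem_FP fstF_mem_FP (fanoutFn_mem_FP powNext_mem_FP cntNext_mem_FP)

/-- **`logU ∈ FP`** (a clocked loop of linear growth, `iterate_mem_FP_of_growth`).
[Arora–Barak 2009, §1.4.1] [folklore] -/
theorem logU_mem_FP : logU ∈ FP :=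
  comp_mem_FP (sndPow_mem_FP 1) (comp_mem_FP
    (iterate_mem_FP_of_growth logRound_mem_FP 7 fstF_logRound length_logRound_le X)
    (fanoutFn_mem_FP OracleCompose.id_mem_FP (const_mem_FP _)))

/-! ### The arithmetic of Thm 5.5's lengths in unary -/

/-- **`seedU c w = 1^{seedLen |w|}`** with `seedLen n = (⌊log₂ n⌋ + 1) + n + 3n^c`
(`CondParams.seedLen`). [Y. Liu, R. Pass, FOCS 2020, proof of Thm 5.5 (`n' = log n + n + 3n^c`)] [folklore] -/
noncomputable def seedU (c : ℕ) : List Bool → List Bool :=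
  concatFn ∘ fanoutFn logU (List.cons true ∘ concatFn ∘ fanoutFn onesFn (polyFn (C 3 * X ^ c)))

/-- **`innerU γ w = 1^{|w| + γ⌊log₂ |w|⌋}`** (`lpInner γ |w|`). [folklore] -/
noncomputable def innerU (γ : ℕ) : List Bool → List Bool :=
  concatFn ∘ fanoutFn onesFn (HashBricks.umulFn ∘ fanoutFn (fun _ => ones γ) logU)

/-- `onesFn w = 1^{|w|}`. [folklore] -/
theorem onesFn_eq_ones (w : List Bool) : onesFn w = ones w.length := unaryEncodeNat_eq_ones _

/-- Value of `seedU`. [folklore] -/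
@[simp] theorem seedU_apply (Q : CondParams) (w : List Bool) : seedU Q.c w = ones (Q.seedLen w.length) := by
  simp only [seedU, Function.comp_apply, fanoutFn_apply, concatFn_boolPair, logU_apply, onesFn_eq_ones, polyFn_apply,
    eval_mul, eval_C, eval_pow, eval_X, Com.ones_append, CondParams.seedLen, CondParams.b, CondParams.m]
  rw [show Nat.log 2 w.length + 1 + (w.length + 3 * w.length ^ Q.c) =
      Nat.log 2 w.length + ((w.length + 3 * w.length ^ Q.c) + 1) from by omega,
    ← Com.ones_append (Nat.log 2 w.length), ← true_cons_ones (w.length + 3 * w.length ^ Q.c)]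

/-- Value of `innerU`. [folklore] -/
@[simp] theorem innerU_apply (γ : ℕ) (w : List Bool) : innerU γ w = ones (lpInner γ w.length) := by
  simp only [innerU, Function.comp_apply, fanoutFn_apply, concatFn_boolPair, onesFn_eq_ones, logU_apply,
    HashBricks.umulFn_boolPair, Com.ones_append, lpInner]

/-- `seedU c ∈ FP`. [folklore] -/
theorem seedU_mem_FP (c : ℕ) : seedU c ∈ FP :=
  comp_mem_FP concatFn_mem_FP (fanoutFn_mem_FP logU_mem_FP (comp_mem_FP (cons_mem_FP true)
    (comp_mem_FP concatFn_mem_FP (fanoutFn_mem_FP onesFn_mem_FP (polyFn_mem_FP _)))))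

/-- `innerU γ ∈ FP`. [folklore] -/
theorem innerU_mem_FP (γ : ℕ) : innerU γ ∈ FP :=
  comp_mem_FP concatFn_mem_FP (fanoutFn_mem_FP onesFn_mem_FP
    (comp_mem_FP HashBricks.umulFn_mem_FP (fanoutFn_mem_FP (const_mem_FP _) logU_mem_FP)))

/-! ### The reduction as a pipeline on `⟨⟨a, z⟩, coins⟩` -/

section Pipeline

variable (Q : CondParams) (D' : RandAlg (List Bool) Bool) (qD : Polynomial ℕ)

/-- `1ⁿ`, `n = |a|`. [folklore] -/
noncomputable def uFn : List Bool → List Bool := onesFn ∘ fstF ∘ fstF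
/-- `1^{seedLen (n+1)}`. [folklore] -/
noncomputable def s1U : List Bool → List Bool := seedU Q.c ∘ List.cons true ∘ uFn
/-- `1^{K_b(n)}`, `K_b(n) = q_D(2 seedLen(n+1) + 2 + lpInner γ (seedLen(n+1))) + 1`. [folklore] -/
noncomputable def kbU : List Bool → List Bool :=
  List.cons true ∘ polyFn qD ∘ concatFn ∘
    fanoutFn (s1U Q) (concatFn ∘ fanoutFn (s1U Q) (List.cons true ∘ List.cons true ∘ innerU Q.γ ∘ s1U Q))
/-- `1^{Base(n)}`, `Base(n) = seedLen(n+1) · K_b(n)`. [folklore] -/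
noncomputable def baseU : List Bool → List Bool := HashBricks.umulFn ∘ fanoutFn (s1U Q) (kbU Q qD)
/-- `1^{|coins| mod Base(n)}`. [folklore] -/
noncomputable def advU : List Bool → List Bool := modLenFn ∘ fanoutFn (baseU Q qD) sndF
/-- `⟨1^{bxv}, 1^κ⟩ = divMod (|coins| mod Base(n)) K_b(n)`. [folklore] -/
noncomputable def dmU : List Bool → List Bool := divModFn ∘ fanoutFn (kbU Q qD) (advU Q qD)
/-- `1^{bxv}`. [folklore] -/
noncomputable def bxvU : List Bool → List Bool := fstF ∘ dmU Q qD
/-- `1^κ`. [folklore] -/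
noncomputable def kapU : List Bool → List Bool := sndF ∘ dmU Q qD
/-- `1^N`, `N = seedLen n + bxv`. [folklore] -/
noncomputable def bigNU : List Bool → List Bool := concatFn ∘ fanoutFn (seedU Q.c ∘ uFn) (bxvU Q qD)
/-- `1^{lpInner γ N}`. [folklore] -/
noncomputable def bigLU : List Bool → List Bool := innerU Q.γ ∘ bigNU Q qD
/-- The sample handed to `D'`: `(z ‖ coins ↾ bxv) ↾ lpInner γ N`. [folklore] -/
noncomputable def sampleF : List Bool → List Bool :=
  takeFn ∘ fanoutFn (bigLU Q qD) (concatFn ∘ fanoutFn (sndF ∘ fstF) (takeFn ∘ fanoutFn (bxvU Q qD) sndF))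
/-- `D'`'s coins `(coins ⇂ bxv) ↾ κ`. [folklore] -/
noncomputable def dcoinsF : List Bool → List Bool :=
  takeFn ∘ fanoutFn (kapU Q qD) (dropFn ∘ fanoutFn (bxvU Q qD) sndF)
/-- The query `⟨⟨1^N, sample⟩, coins'⟩`. [folklore] -/
noncomputable def queryF : List Bool → List Bool := fanoutFn (fanoutFn (bigNU Q qD) (sampleF Q qD)) (dcoinsF Q qD)
/-- `D'` as a string function `⟨x, ρ⟩ ↦ encodeBool (D'(x; ρ))`. [folklore] -/
noncomputable def dStr : List Bool → List Bool :=
  (fun p : List Bool × List Bool => encodeBool (D'.run p.1 p.2)) ∘ boolUnpair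
/-- **The run function of the reduction as a string function on `⟨inp, coins⟩`.** [folklore] -/
noncomputable def redF : List Bool → List Bool := dStr D' ∘ queryF Q qD

variable {Q D' qD}

/-- `uFn ∈ FP`. [folklore] -/
theorem uFn_mem_FP : uFn ∈ FP := comp_mem_FP onesFn_mem_FP (comp_mem_FP fstF_mem_FP fstF_mem_FP)
/-- `s1U ∈ FP`. [folklore] -/
theorem s1U_mem_FP : s1U Q ∈ FP := comp_mem_FP (seedU_mem_FP _) (comp_mem_FP (cons_mem_FP true) uFn_mem_FP)
/-- `kbU ∈ FP`. [folklore] -/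
theorem kbU_mem_FP : kbU Q qD ∈ FP :=
  comp_mem_FP (cons_mem_FP true) (comp_mem_FP (polyFn_mem_FP qD) (comp_mem_FP concatFn_mem_FP
    (fanoutFn_mem_FP s1U_mem_FP (comp_mem_FP concatFn_mem_FP (fanoutFn_mem_FP s1U_mem_FP
      (comp_mem_FP (cons_mem_FP true) (comp_mem_FP (cons_mem_FP true) (comp_mem_FP (innerU_mem_FP _) s1U_mem_FP))))))))
/-- `baseU ∈ FP`. [folklore] -/
theorem baseU_mem_FP : baseU Q qD ∈ FP :=
  comp_mem_FP HashBricks.umulFn_mem_FP (fanoutFn_mem_FP s1U_mem_FP kbU_mem_FP)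
/-- `advU ∈ FP`. [folklore] -/
theorem advU_mem_FP : advU Q qD ∈ FP := comp_mem_FP modLenFn_mem_FP (fanoutFn_mem_FP baseU_mem_FP sndF_mem_FP)
/-- `dmU ∈ FP`. [folklore] -/
theorem dmU_mem_FP : dmU Q qD ∈ FP := comp_mem_FP divModFn_mem_FP (fanoutFn_mem_FP kbU_mem_FP advU_mem_FP)
/-- `bxvU ∈ FP`. [folklore] -/
theorem bxvU_mem_FP : bxvU Q qD ∈ FP := comp_mem_FP fstF_mem_FP dmU_mem_FP
/-- `kapU ∈ FP`. [folklore] -/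
theorem kapU_mem_FP : kapU Q qD ∈ FP := comp_mem_FP sndF_mem_FP dmU_mem_FP
/-- `bigNU ∈ FP`. [folklore] -/
theorem bigNU_mem_FP : bigNU Q qD ∈ FP :=
  comp_mem_FP concatFn_mem_FP (fanoutFn_mem_FP (comp_mem_FP (seedU_mem_FP _) uFn_mem_FP) bxvU_mem_FP)
/-- `bigLU ∈ FP`. [folklore] -/
theorem bigLU_mem_FP : bigLU Q qD ∈ FP := comp_mem_FP (innerU_mem_FP _) bigNU_mem_FP
/-- `sampleF ∈ FP`. [folklore] -/
theorem sampleF_mem_FP : sampleF Q qD ∈ FP :=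
  comp_mem_FP takeFn_mem_FP (fanoutFn_mem_FP bigLU_mem_FP (comp_mem_FP concatFn_mem_FP
    (fanoutFn_mem_FP (comp_mem_FP sndF_mem_FP fstF_mem_FP) (comp_mem_FP takeFn_mem_FP (fanoutFn_mem_FP bxvU_mem_FP sndF_mem_FP)))))
/-- `dcoinsF ∈ FP`. [folklore] -/
theorem dcoinsF_mem_FP : dcoinsF Q qD ∈ FP :=
  comp_mem_FP takeFn_mem_FP (fanoutFn_mem_FP kapU_mem_FP (comp_mem_FP dropFn_mem_FP (fanoutFn_mem_FP bxvU_mem_FP sndF_mem_FP)))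
/-- `queryF ∈ FP`. [folklore] -/
theorem queryF_mem_FP : queryF Q qD ∈ FP :=
  fanoutFn_mem_FP (fanoutFn_mem_FP bigNU_mem_FP sampleF_mem_FP) dcoinsF_mem_FP
/-- `redF ∈ FP` for a polynomial-time `D'` (presented as the string function `dStr D'`). [folklore] -/
theorem redF_mem_FP (hD : dStr D' ∈ FP) : redF Q D' qD ∈ FP := comp_mem_FP hD queryF_mem_FP

/-! #### Values on `⟨inp, coins⟩` -/

variable (Q qD)

/-- `uFn ⟨inp, coins⟩ = 1ⁿ`, `n = |(boolUnpair inp).1|`. [folklore] -/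
theorem uFn_boolPair (inp coins : List Bool) : uFn (boolPair inp coins) = ones (boolUnpair inp).1.length := by
  simp [uFn, fstF, onesFn_eq_ones]

/-- `s1U ⟨inp, coins⟩ = 1^{seedLen (n+1)}`. [folklore] -/
theorem s1U_boolPair (inp coins : List Bool) :
    s1U Q (boolPair inp coins) = ones (Q.seedLen ((boolUnpair inp).1.length + 1)) := by
  simp only [s1U, Function.comp_apply, uFn_boolPair, true_cons_ones, seedU_apply, List.length_replicate]

/-- `kbU ⟨inp, coins⟩ = 1^{K_b(n)}`. [folklore] -/
theorem kbU_boolPair (inp coins : List Bool) :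
    kbU Q qD (boolPair inp coins) = ones (Q.Kb qD (boolUnpair inp).1.length) := by
  simp only [kbU, Function.comp_apply, fanoutFn_apply, s1U_boolPair, concatFn_boolPair, innerU_apply, List.length_replicate,
    true_cons_ones, Com.ones_append, polyFn_apply, CondParams.Kb]
  generalize Q.seedLen ((boolUnpair inp).1.length + 1) = s
  rw [show s + (s + (lpInner Q.γ s + 1 + 1)) = 2 * s + 2 + lpInner Q.γ s from by omega]

/-- `baseU ⟨inp, coins⟩ = 1^{Base(n)}`. [folklore] -/
theorem baseU_boolPair (inp coins : List Bool) :
    baseU Q qD (boolPair inp coins) = ones (Q.Base qD (boolUnpair inp).1.length) := by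
  simp only [baseU, Function.comp_apply, fanoutFn_apply, s1U_boolPair, kbU_boolPair, HashBricks.umulFn_boolPair, CondParams.Base]

/-- `dmU ⟨inp, coins⟩ = ⟨1^{bxv}, 1^κ⟩`. [folklore] -/
theorem dmU_boolPair (inp coins : List Bool) :
    dmU Q qD (boolPair inp coins) =
      boolPair (ones (coins.length % Q.Base qD (boolUnpair inp).1.length / Q.Kb qD (boolUnpair inp).1.length))
        (ones (coins.length % Q.Base qD (boolUnpair inp).1.length % Q.Kb qD (boolUnpair inp).1.length)) := by
  simp only [dmU, advU, Function.comp_apply, fanoutFn_apply, kbU_boolPair, baseU_boolPair, sndF_boolPair, modLenFn_boolPair,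
    divModFn_boolPair]

/-- `bigNU ⟨inp, coins⟩ = 1^{seedLen n + bxv}`. [folklore] -/
theorem bigNU_boolPair (inp coins : List Bool) :
    bigNU Q qD (boolPair inp coins) = ones (Q.seedLen (boolUnpair inp).1.length
      + coins.length % Q.Base qD (boolUnpair inp).1.length / Q.Kb qD (boolUnpair inp).1.length) := by
  simp only [bigNU, bxvU, Function.comp_apply, fanoutFn_apply, uFn_boolPair, seedU_apply, List.length_replicate, dmU_boolPair,
    fstF_boolPair, concatFn_boolPair, Com.ones_append]

/-- **The pipeline computes the run function of the reduction.** [Y. Liu, R. Pass, FOCS 2020, proof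
of Thm 5.5] [folklore] -/
theorem redF_boolPair (D' : RandAlg (List Bool) Bool) (inp coins : List Bool) :
    redF Q D' qD (boolPair inp coins) = encodeBool (Q.redRun D' qD inp coins) := by
  simp only [redF, queryF, sampleF, dcoinsF, bigLU, kapU, bxvU, dStr, Function.comp_apply, fanoutFn_apply,
    bigNU_boolPair, dmU_boolPair, fstF_boolPair, sndF_boolPair, innerU_apply, List.length_replicate, takeFn_boolPair,
    dropFn_boolPair, concatFn_boolPair, boolUnpair_boolPair, CondParams.redRun, unaryEncodeNat_eq_ones]
  rfl

end Pipeline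

end CondRed

/-! ### The discharge -/

/-- **Discharge of `condRedRun_polyTime`**: for every PPT `D'`, the run function of the reduction
of Thm 5.5 (`CondParams.redRun`) is polynomial time on the pair presentation of (input, coins) —
the `FP` pipeline `CondRed.redF` around one call of `D'`. [Y. Liu, R. Pass, FOCS 2020, proof of
Thm 5.5] [cite: LiuPassFOCS2020, Thm 5.5 (proof)] -/
theorem condRedRun_polyTime_holds : condRedRun_polyTime := by
  intro Q D' qD hD'
  have h1 : PolyTimeComputable (fun p : List Bool × List Bool => boolPair p.1 p.2) encodeBool
      (fun p : List Bool × List Bool => D'.run p.1 p.2) := by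
    obtain ⟨p, M, hM⟩ := hD'.1
    exact ⟨p, M, fun a => hM a⟩
  have hd : CondRed.dStr D' ∈ FP := PolyTimeComputable.comp_holds h1 polyTimeComputable_boolUnpair
  obtain ⟨p, M, hM⟩ := CondRed.redF_mem_FP (Q := Q) (qD := qD) hd
  refine ⟨p, M, fun q => ?_⟩
  have hrun := hM (boolPair q.1 q.2)
  simp only [id_eq] at hrun
  rw [CondRed.redF_boolPair] at hrun
  exact hrun

/-- **Liu–Pass Thm 5.5 from Lemma 5.3 and the efficiency of the generator alone** (the reduction's
efficiency discharged here). [Y. Liu, R. Pass, FOCS 2020, Thm 5.5] [cite: LiuPassFOCS2020, Thm 5.5] -/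
theorem condEPPRG_of_OWFExist_of_lemma53_gen (h53 : liuPass_lemma53) (hGeff : condGen_polyTime) :
    condEPPRG_of_OWFExist :=
  condEPPRG_of_OWFExist_of_lemma53 h53 hGeff condRedRun_polyTime_holds

end Literature.Computability.Cryptography
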